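import Mathlib.RepresentationTheory.Homological.GroupHomology.LowDegree
import HarnessLib

/-!
# The universal property of `H₁(Γ, R)` with trivial coefficients: an additive map `ψ : Γ → M` into an
# `R`-module induces the `R`-linear map `H₁(Γ, R) → M`, `[γ ⊗ a] ↦ a · ψ(γ)` (Brown II §3, `H₁Γ = Γ_ab`)

Topic `Literature/Algebra/Homology`; namespace `Literature.Algebra.Homology.H1Trivial`.  Definitions with bodies and
proved theorems; no named fact, no `sorry`, no instance, no notation.

Mathlib has `groupHomology.H1AddEquivOfIsTrivial : H₁(G, A) ≃+ G_ab ⊗_ℤ A` (trivial `A`), additive only.  For a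
commutative ring `R` and an `R`-module `M`, an additive map `ψ : Additive Γ →+ M` (i.e. `ψ(γδ) = ψ(γ) + ψ(δ)`)
gives

* `tensorLift R ψ : Γ_ab ⊗_ℤ R →ₗ[ℤ] M`, `⟦γ⟧ ⊗ a ↦ a • ψ(γ)` (through `Abelianization.lift`);
* `liftAddHom R ψ : H₁(Γ, R) →+ M` and its `R`-linearity `liftAddHom_smul` (checked on the generators
  `[γ ⊗ a] = H1π [single γ a]`, which exhaust `H₁` additively);
* **`lift R ψ : H₁(Γ, R) →ₗ[R] M`**, `lift_single` (`[γ ⊗ a] ↦ a • ψ(γ)`), **`range_lift`**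
  (`range = R ∙ span (range ψ)`).

Consumer: `NumberTheory/ModularSymbols/FullLevelHomologyCuspidalClass` — the period symbols
`γ ↦ {∞, γ∞} ⊗ 1 ∈ H₁(X₀(N), R)` (Manin's relation makes them additive on `Γ₀(N)`) induce
`H₁(Γ₀(N), R) ↠ H₁(X₀(N), R)`.

## References
* K. S. Brown, *Cohomology of Groups*, GTM 87 (1982), Ch. II §3 (`H₁(G, ℤ) ≅ G_ab`), Ch. III §1 (coefficients). [Brown1982]
-/

noncomputable section

open CategoryTheory groupHomology Finsupp TensorProduct

universe u v

namespace Literature.Algebra.Homology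

namespace H1Trivial

variable (R : Type u) [CommRing R] {Γ : Type u} [Group Γ] {M : Type v} [AddCommGroup M] [Module R M]
  (ψ : Additive Γ →+ M)

/-- The additive map `Γ_ab ⊗_ℤ R → M`, `⟦γ⟧ ⊗ a ↦ a • ψ(γ)`. [cite: Brown1982, Ch. II §3] -/
def tensorLift : (Additive (Abelianization Γ)) ⊗[ℤ] R →ₗ[ℤ] M :=
  TensorProduct.lift
    { toFun := fun x =>
        { toFun := fun a : R => a • (AddMonoidHom.toMultiplicativeRight.symm
            (Abelianization.lift (AddMonoidHom.toMultiplicativeRight ψ))) x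
          map_add' := fun a b => add_smul a b _
          map_smul' := fun n a => by
            rw [RingHom.id_apply, smul_assoc] }
      map_add' := fun x y => by ext a; simp [smul_add]
      map_smul' := fun n x => by ext a; simp [smul_comm a n] }

/-- `tensorLift (⟦γ⟧ ⊗ a) = a • ψ(γ)`. [cite: Brown1982, Ch. II §3] -/
theorem tensorLift_tmul (γ : Γ) (a : R) :
    tensorLift R ψ (Additive.ofMul (Abelianization.of γ) ⊗ₜ[ℤ] a) = a • ψ (Additive.ofMul γ) := by
  simp [tensorLift]

/-- `[γ ⊗ a] ↦ a • ψ(γ)` as an additive map `H₁(Γ, R) → M` (via Mathlib's `H₁(Γ, R) ≃+ Γ_ab ⊗ R`).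
[cite: Brown1982, Ch. II §3] -/
def liftAddHom : H1 (Rep.trivial R Γ R) →+ M :=
  (tensorLift R ψ).toAddMonoidHom.comp (H1AddEquivOfIsTrivial (Rep.trivial R Γ R)).toAddMonoidHom

/-- `liftAddHom [γ ⊗ a] = a • ψ(γ)`. [cite: Brown1982, Ch. II §3] -/
theorem liftAddHom_single (γ : Γ) (a : R) :
    liftAddHom R ψ (H1π _ ((cycles₁IsoOfIsTrivial (Rep.trivial R Γ R)).inv (single γ a))) =
      a • ψ (Additive.ofMul γ) := by
  simp only [liftAddHom, AddMonoidHom.coe_comp, Function.comp_apply, AddEquiv.coe_toAddMonoidHom,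
    LinearMap.toAddMonoidHom_coe]
  rw [H1AddEquivOfIsTrivial_single, tensorLift_tmul]

/-- `liftAddHom` is `R`-linear. [cite: Brown1982, Ch. II §3] -/
theorem liftAddHom_smul (c : R) (z : H1 (Rep.trivial R Γ R)) :
    liftAddHom R ψ (c • z) = c • liftAddHom R ψ z := by
  induction z using H1_induction_on with
  | h x =>
    -- reduce to the chain level: `x = iso.inv x.1`, and `x.1` is a finite sum of singles
    have hx : x = (cycles₁IsoOfIsTrivial (Rep.trivial R Γ R)).inv x.1 :=
      Subtype.ext (cycles₁IsoOfIsTrivial_inv_apply _).symm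
    rw [hx]
    generalize x.1 = f
    induction f using Finsupp.induction_linear with
    | zero => simp
    | add f₁ f₂ h₁ h₂ => simp only [map_add, smul_add, h₁, h₂]
    | single γ a =>
      rw [← map_smul, ← map_smul, smul_single, liftAddHom_single, liftAddHom_single, smul_eq_mul, mul_smul]

/-- **The universal property of `H₁(Γ, R)` (trivial coefficients)**: the `R`-linear map `H₁(Γ, R) → M`,
`[γ ⊗ a] ↦ a • ψ(γ)`, attached to an additive map `ψ : Γ → M`. [cite: Brown1982, Ch. II §3 (`H₁G = G_ab`)] -/
def lift : H1 (Rep.trivial R Γ R) →ₗ[R] M where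
  toFun := liftAddHom R ψ
  map_add' := map_add _
  map_smul' := liftAddHom_smul R ψ

/-- `lift ψ [γ ⊗ a] = a • ψ(γ)`. [cite: Brown1982, Ch. II §3] -/
theorem lift_single (γ : Γ) (a : R) :
    lift R ψ (H1π _ ((cycles₁IsoOfIsTrivial (Rep.trivial R Γ R)).inv (single γ a))) = a • ψ (Additive.ofMul γ) :=
  liftAddHom_single R ψ γ a

/-- The range of `lift ψ` is the `R`-span of the image of `ψ`. [cite: Brown1982, Ch. II §3] -/
theorem range_lift : LinearMap.range (lift R ψ) = Submodule.span R (Set.range ψ) := by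
  apply le_antisymm
  · rintro _ ⟨z, rfl⟩
    induction z using H1_induction_on with
    | h x =>
      have hx : x = (cycles₁IsoOfIsTrivial (Rep.trivial R Γ R)).inv x.1 :=
        Subtype.ext (cycles₁IsoOfIsTrivial_inv_apply _).symm
      rw [hx]
      generalize x.1 = f
      induction f using Finsupp.induction_linear with
      | zero => simp
      | add f₁ f₂ h₁ h₂ => simp only [map_add]; exact Submodule.add_mem _ h₁ h₂
      | single γ a =>
        rw [lift_single]
        exact Submodule.smul_mem _ a (Submodule.subset_span ⟨Additive.ofMul γ, rfl⟩)
  · rw [Submodule.span_le]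
    rintro _ ⟨γ, rfl⟩
    refine ⟨H1π _ ((cycles₁IsoOfIsTrivial (Rep.trivial R Γ R)).inv (single (Additive.toMul γ) 1)), ?_⟩
    rw [lift_single, one_smul]
    rfl

end H1Trivial

end Literature.Algebra.Homology
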